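import Mathlib.Analysis.InnerProductSpace.PiL2
import HarnessLib

/-!
# Forced run ends: blocked bond lines end inside the cell (riser ledger, counting step)

HONEST FRAMING. Part of the venture `Summits/Ventures/Crystal3D` (cell `crystal3d-full`), helper
`--supports` the crux `CoaxialWallLaw` (stmt-Ventures-19481, `route-Ventures-StickyWulffConstant`),
REGISTERED line `WallLedgerF` (planner cf-p1 gen 16), stub `stub_coaxialTwoSlabAdhesion`
(terrace/riser slot ledger).  Pure finite combinatorics; usable by `WallLedgerG` too.

THE COUNTING STEP OF THE RISER LEDGER.  `2·D(X) = Σ_balls (#vacant slots − #foreign contacts)`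
(`…TwoGrainLedger`, `…SingleVacancy`); the riser term is the number of balls `x` of a grain with a
VACANT in-plane slot `x + w ∉ X`.  Such vacancies are forced along every in-plane bond line that
starts in the clamped slab of one grain and runs into the clamped slab of the other grain (where
its sites are blocked by the other lattice): the run of occupied sites beginning at the ANCHOR
`a ∈ X` must end before the first blocked site.  This file isolates that step:

* `card_le_card_vacant_of_blocked` — if `A ⊆ S` is a set of anchors lying on pairwise distinct
  lines of direction `w`, and on each anchor's line some later site `a + (k+1)•w` is missing from
  `S`, then `S` has at least `#A` points `x` with `x + w ∉ S` (the map anchor ↦ last occupied site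
  before the first gap is injective);
* `card_le_card_vacant_of_blocked_neg` — the same towards `−w`.

The geometric count of anchors (in-plane lines of a moved lattice through the clamped slab that
reach the opposite slab inside the disc: `√2|⟪w,e₃⟫|πρ² − C(1+h)ρ` of them, via
`lineCount_offset_window`) is separate work.
WHAT THIS IS NOT: any geometry; the stub; rung F-C1 not moved.
-/

noncomputable section

namespace Summit.Ventures.Crystal3D.Theorems

open Finset

/-- **Blocked lines force run ends.**  `S` a finite set of points, `w` a vector, `A ⊆ S` anchors on
pairwise distinct `w`-lines (`a' ≠ a + k•w` for integers `k` when `a ≠ a'`), and for every anchor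
some later site `a + (k+1)•w` (`k : ℕ`) is not in `S`.  Then
`#A ≤ #{x ∈ S : x + w ∉ S}`. -/
theorem card_le_card_vacant_of_blocked (S A : Finset (EuclideanSpace ℝ (Fin 3)))
    (w : EuclideanSpace ℝ (Fin 3)) (hA : A ⊆ S)
    (hlines : ∀ a ∈ A, ∀ a' ∈ A, a ≠ a' → ∀ k : ℤ, a' ≠ a + (k : ℝ) • w)
    (hblock : ∀ a ∈ A, ∃ k : ℕ, a + ((k : ℝ) + 1) • w ∉ S) :
    A.card ≤ (S.filter fun x => x + w ∉ S).card := by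
  classical
  -- the first gap after each anchor
  let K : EuclideanSpace ℝ (Fin 3) → ℕ := fun a =>
    if h : ∃ k : ℕ, a + ((k : ℝ) + 1) • w ∉ S then Nat.find h else 0
  let f : EuclideanSpace ℝ (Fin 3) → EuclideanSpace ℝ (Fin 3) := fun a => a + ((K a : ℕ) : ℝ) • w
  have hKspec : ∀ a ∈ A, a + (((K a : ℕ) : ℝ) + 1) • w ∉ S := by
    intro a ha
    have h := hblock a ha
    simp only [K, dif_pos h]
    exact Nat.find_spec h
  have hKmin : ∀ a ∈ A, ∀ j : ℕ, j < K a → a + ((j : ℝ) + 1) • w ∈ S := by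
    intro a ha j hj
    have h := hblock a ha
    simp only [K, dif_pos h] at hj
    have := Nat.find_min h hj
    simpa using this
  -- `f a ∈ S` and `f a + w ∉ S`
  have hf : ∀ a ∈ A, f a ∈ S.filter fun x => x + w ∉ S := by
    intro a ha
    rw [mem_filter]
    constructor
    · rcases Nat.eq_zero_or_pos (K a) with h0 | hpos
      · simp only [f, h0, Nat.cast_zero, zero_smul, add_zero]
        exact hA ha
      · obtain ⟨j, hj⟩ : ∃ j : ℕ, K a = j + 1 := ⟨K a - 1, by omega⟩
        have hmem := hKmin a ha j (by omega)
        simp only [f, hj]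
        push_cast
        exact hmem
    · have h := hKspec a ha
      have e : a + ((K a : ℕ) : ℝ) • w + w = a + (((K a : ℕ) : ℝ) + 1) • w := by
        rw [add_smul, one_smul, add_assoc]
      show a + ((K a : ℕ) : ℝ) • w + w ∉ S
      rw [e]; exact h
  -- injectivity on `A`
  have hinj : Set.InjOn f A := by
    intro a ha a' ha' hfa
    by_contra hne
    simp only [f] at hfa
    have e : a' = a + ((K a : ℕ) : ℝ) • w - ((K a' : ℕ) : ℝ) • w := eq_sub_of_add_eq hfa.symm
    have e' : a + ((K a : ℕ) : ℝ) • w - ((K a' : ℕ) : ℝ) • w =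
        a + (((K a : ℤ) - (K a' : ℤ) : ℤ) : ℝ) • w := by
      push_cast; rw [sub_smul]; abel
    exact hlines a ha a' ha' hne _ (e.trans e')
  calc A.card = (A.image f).card := (card_image_of_injOn hinj).symm
    _ ≤ (S.filter fun x => x + w ∉ S).card := card_le_card (fun y hy => by
        obtain ⟨a, ha, rfl⟩ := mem_image.1 hy
        exact hf a ha)

/-- The same towards `−w`: anchors whose lines are blocked BELOW give points `x ∈ S` with
`x − w ∉ S`. -/
theorem card_le_card_vacant_of_blocked_neg (S A : Finset (EuclideanSpace ℝ (Fin 3)))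
    (w : EuclideanSpace ℝ (Fin 3)) (hA : A ⊆ S)
    (hlines : ∀ a ∈ A, ∀ a' ∈ A, a ≠ a' → ∀ k : ℤ, a' ≠ a + (k : ℝ) • w)
    (hblock : ∀ a ∈ A, ∃ k : ℕ, a - ((k : ℝ) + 1) • w ∉ S) :
    A.card ≤ (S.filter fun x => x - w ∉ S).card := by
  have h := card_le_card_vacant_of_blocked S A (-w) hA
    (fun a ha a' ha' hne k => by
      have := hlines a ha a' ha' hne (-k)
      rwa [Int.cast_neg, neg_smul, ← smul_neg] at this)
    (fun a ha => by
      obtain ⟨k, hk⟩ := hblock a ha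
      exact ⟨k, by rwa [smul_neg, ← sub_eq_add_neg]⟩)
  have e : (S.filter fun x => x + -w ∉ S) = S.filter fun x => x - w ∉ S := by
    simp only [sub_eq_add_neg]
  rwa [e] at h

end Summit.Ventures.Crystal3D.Theorems

end
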